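import Mathlib
import HarnessLib

/-!
# No probability law on the product σ-algebra of `ℝ → (ℝ³ → ℝ³)` is carried by jointly continuous
  fields (support lemma for the `MeanFieldTypeI` items stmt-NavierStokesRegularity-1681/1682/1683/1687)

**Statement.** Let `μ` be a probability measure on the function type `ℝ → (E → F)` equipped with
the instance σ-algebra `MeasurableSpace.pi` (the product σ-algebra over the time axis).  Then it is
FALSE that `μ`-almost every `u` has `Function.uncurry u` continuous on the open slab
`Set.Iio 0 ×ˢ Set.univ` (for `E` a nontrivial real normed space, `F` with two distinct points —
here `E = F = ℝ³`).

PROOF. A measurable set of the product σ-algebra depends on countably many coordinates (Mathlib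
`MeasurableSet.eq_preimage_restrict_countable`): the measurable null set `N ⊇ {u | ¬ good u}` is
`I.restrict ⁻¹' S` with `I ⊆ ℝ` countable. Pick a time `t₀ < 0` outside `I` (a countable set is
Lebesgue-null, `Set.Iio 0` is not). For ANY `u`, the field `u' := update u t₀ bad`, `bad` a slice
discontinuous at the origin, is not jointly continuous on the slab, so `u' ∈ N`; `u'` agrees with
`u` on `I`, so `u ∈ N`. Hence `N = univ` has measure `1 ≠ 0`.

USE. The `MeanFieldTypeI` route quantifies over `μ : Measure (ℝ → ℝ³ → ℝ³)` with the hypothesis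
`∀ᵐ u ∂μ, IsAncientMildSolution 1 u ∧ ContDiffOn ℝ ⊤ (uncurry u) (Iio 0 ×ˢ univ) ∧ …`; by this
lemma that hypothesis is contradictory for every probability measure, so the items carrying it
as a hypothesis are VACUOUSLY true as typed (refuter verdict «misstated», route review 2026-08-17,
evidence `Vacuity26.lean`; made kernel-definitive here so that the planner restates the
statistics over a σ-algebra that can carry path laws).

HONEST FRAMING: a measure-theoretic bookkeeping fact about the typed σ-algebra; it says nothing
about Type-I statistics of Navier–Stokes and nothing about regularity.
-/

noncomputable section

set_option linter.dupNamespace false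

namespace Summit.NavierStokesRegularity.NavierStokesRegularity.Theorems

open Set MeasureTheory Filter Topology Function

/-- The slice `{0}.indicator (fun _ => e)` (`= e` at the origin, `0` elsewhere) with `e ≠ 0` is not
continuous at the origin of a real normed space containing a nonzero vector. [folklore] -/
theorem not_continuousAt_indicator_singleton_zero {E F : Type*} [NormedAddCommGroup E]
    [NormedSpace ℝ E] [NormedAddCommGroup F] {e : F} (he : e ≠ 0) {v : E} (hv : v ≠ 0) :
    ¬ ContinuousAt (({0} : Set E).indicator fun _ => e) 0 := by
  intro hc
  -- the sequence `(n+1)⁻¹ • v → 0` avoids the origin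
  set s : ℕ → E := fun n => ((n : ℝ) + 1)⁻¹ • v with hs
  have hs0 : Tendsto s atTop (𝓝 0) := by
    have h1 : Tendsto (fun n : ℕ => ((n : ℝ) + 1)⁻¹) atTop (𝓝 0) :=
      tendsto_inv_atTop_zero.comp
        (tendsto_atTop_add_const_right atTop 1 tendsto_natCast_atTop_atTop)
    simpa using h1.smul_const v
  have hne : ∀ n, s n ≠ 0 := fun n =>
    smul_ne_zero (inv_ne_zero (Nat.cast_add_one_pos n).ne') hv
  have hlim := hc.tendsto.comp hs0
  have hconst : (({0} : Set E).indicator fun _ => e) ∘ s = fun _ => 0 := by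
    funext n
    exact Set.indicator_of_notMem (by simpa using hne n) _
  rw [hconst, Set.indicator_of_mem (Set.mem_singleton _)] at hlim
  exact he (tendsto_nhds_unique hlim tendsto_const_nhds)

/-- **No probability law on the product σ-algebra of `ℝ → (E → F)` is carried by fields jointly
continuous on the slab `(-∞, 0) × E`** (`E` a real normed space with a nonzero vector, `F` with a
nonzero vector): measurable sets of `MeasurableSpace.pi` depend on countably many times
(`MeasurableSet.eq_preimage_restrict_countable`), and modifying a field at one further time
destroys joint continuity. [folklore] -/
theorem not_ae_continuousOn_uncurry_slab {E F : Type*} [NormedAddCommGroup E] [NormedSpace ℝ E]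
    [MeasurableSpace (E → F)] [NormedAddCommGroup F] {v : E} (hv : v ≠ 0) {e : F} (he : e ≠ 0)
    (μ : Measure (ℝ → E → F)) [IsProbabilityMeasure μ] :
    ¬ (∀ᵐ u ∂μ, ContinuousOn (uncurry u) (Iio (0 : ℝ) ×ˢ (univ : Set E))) := by
  classical
  intro h
  rw [ae_iff] at h
  obtain ⟨N, hsub, hN, hμN⟩ := exists_measurable_superset_of_null h
  obtain ⟨I, S, hI, hNS⟩ := hN.eq_preimage_restrict_countable
  -- a time `t₀ < 0` not among the countably many coordinates `I`
  have hne : (Iio (0 : ℝ) \ I).Nonempty := by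
    refine nonempty_of_measure_ne_zero (μ := volume) ?_
    rw [measure_sdiff_null (hI.measure_zero volume), Real.volume_Iio]
    exact ENNReal.top_ne_zero
  obtain ⟨t₀, ht₀, ht₀I⟩ := hne
  -- the discontinuous slice
  set bad : E → F := ({0} : Set E).indicator fun _ => e with hbad
  -- every field lies in `N`
  have hall : ∀ u : ℝ → E → F, u ∈ N := by
    intro u
    set u' : ℝ → E → F := update u t₀ bad with hu'
    have hu'bad : ¬ ContinuousOn (uncurry u') (Iio (0 : ℝ) ×ˢ (univ : Set E)) := by
      intro hc
      have hsl : Continuous fun x : E => uncurry u' (t₀, x) :=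
        hc.comp_continuous (continuous_const.prodMk continuous_id) fun x => ⟨ht₀, mem_univ x⟩
      have hsl' : (fun x : E => uncurry u' (t₀, x)) = bad := by
        funext x
        simp [hu']
      rw [hsl'] at hsl
      exact not_continuousAt_indicator_singleton_zero he hv hsl.continuousAt
    have hu'N : u' ∈ N := hsub hu'bad
    rw [hNS] at hu'N ⊢
    have hres : I.restrict u = I.restrict u' := by
      funext i
      have hi : (i : ℝ) ≠ t₀ := fun h => ht₀I (h ▸ i.2)
      simp [hu', restrict, hi]
    show I.restrict u ∈ S
    rw [hres]
    exact hu'N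
  have hNu : N = univ := eq_univ_of_forall hall
  rw [hNu, measure_univ] at hμN
  exact one_ne_zero hμN

/-- **The `MeanFieldTypeI` statistics hypothesis is contradictory**: for every probability measure
`μ` on `ℝ → ℝ³ → ℝ³` (instance product σ-algebra) and every predicate `P`, it is false that
`μ`-a.e. `u` satisfies `P u ∧ ContDiffOn ℝ ⊤ (uncurry u) (Iio 0 ×ˢ univ) ∧ Q u`. [folklore] -/
theorem not_ae_contDiffOn_slab
    (μ : Measure (ℝ → EuclideanSpace ℝ (Fin 3) → EuclideanSpace ℝ (Fin 3))) [IsProbabilityMeasure μ]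
    {P Q : (ℝ → EuclideanSpace ℝ (Fin 3) → EuclideanSpace ℝ (Fin 3)) → Prop} :
    ¬ (∀ᵐ u ∂μ, P u ∧ ContDiffOn ℝ (⊤ : ℕ∞) (uncurry u) (Iio (0 : ℝ) ×ˢ univ) ∧ Q u) := by
  intro h
  have hv : (EuclideanSpace.single (0 : Fin 3) (1 : ℝ)) ≠ 0 := by
    intro h0
    have := congrArg (fun w : EuclideanSpace ℝ (Fin 3) => w 0) h0
    simp at this
  exact not_ae_continuousOn_uncurry_slab hv hv μ (h.mono fun u hu => hu.2.1.continuousOn)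

end Summit.NavierStokesRegularity.NavierStokesRegularity.Theorems

end
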